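import Summits.NavierStokesRegularity.NavierStokesRegularity.Theorems.ExtremiserTransienceNearExtremalTransienceExtremiserLiouvilleConstantSpeedSlidePalinstrophyQuotient
import Summits.NavierStokesRegularity.NavierStokesRegularity.Theorems.ExtremiserTransienceNearExtremalTransienceExtremiserLiouvilleConstantSpeedSlideQuotientCurl
import HarnessLib

/-!
# Crux `ExtremiserTransience.NearExtremalTransience` (stmt-NavierStokesRegularity-21883), line `extremiser_liouville`,
# stub K1b — THE PALINSTROPHY INTEGRAND ALONG THE DISCRETE SLIDE, pointwise (record §13, R2′/R3′)

`--supports stmt-NavierStokesRegularity-21883` (helper).  Author: prover seat `ns-el-k1b` (g8).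
For `ψ_h = −h⁻¹φ̂_h`, `Ψ = g(x₂)V`, `ω = curl V`, `D(curl Ψ) = gDω + R` (`R` from `hasFDerivAt_curl_axialWeight_smul`),
`Tᵢ(x) = (∫_{−h}^0 DK₁(x+te₂)eᵢ)e₀ − (∫_{−h}^0 DK₀(x+te₂)eᵢ)e₁` (`Kⱼ = ∂ⱼ(g′V₂)`):
* `fderiv_curl_const_smul_apply` : `D(curl(aφ))(x)w = a·D(curl φ)(x)w`;
* `inner_fderiv_curl_slideQuotient_smul` : **pointwise decomposition**
  `⟪u, D(curl ψ_h)(x)eᵢ⟫ = −g(x₂−h)⟪u, h⁻¹(∂ᵢω(x) − ∂ᵢω(x−he₂))⟫ − h⁻¹(g(x₂) − g(x₂−h))⟪u, ∂ᵢω(x)⟫`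
  `− ⟪u, h⁻¹(R(x) − R(x−he₂))eᵢ⟫ + ⟪u, h⁻¹Tᵢ(x)⟫` for every vector `u` (take `u = ∂ᵢω(x)` and sum over `i`).
Integrating with `u = ∂ᵢω` and applying the shifted discrete product rule (p728345) to the first term gives the palinstrophy
bound R3′ of record §13; the remaining terms converge by the translation toolkit.

WHAT THIS IS NOT: K1b is NOT proved; nothing here proves NS regularity. [folklore]
-/

noncomputable section

open Set Filter Topology MeasureTheory Metric Function InnerProductSpace
open scoped ENNReal NNReal Topology InnerProductSpace RealInnerProductSpace ContDiff
open Literature.Analysis.FluidPDE Literature.Analysis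

namespace Summit.NavierStokesRegularity.NavierStokesRegularity.Theorems

-- the problem directory repeats the summit name (`NavierStokesRegularity/NavierStokesRegularity`)
set_option linter.dupNamespace false

namespace ExtremiserLiouville

open DepletionLadder.KStar

variable {V φ : EuclideanSpace ℝ (Fin 3) → EuclideanSpace ℝ (Fin 3)} {g : ℝ → ℝ}

/-- `D(curl(aφ))(x) = a·D(curl φ)(x)` for `φ ∈ C²`. [folklore] -/
theorem fderiv_curl_const_smul (hφ : ContDiff ℝ 2 φ) (a : ℝ) (x : EuclideanSpace ℝ (Fin 3)) :
    fderiv ℝ (curl (fun y => a • φ y)) x = a • fderiv ℝ (curl φ) x := by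
  have hφd : Differentiable ℝ φ := hφ.differentiable two_ne_zero
  have hcurl : curl (fun y => a • φ y) = fun y => a • curl φ y := by
    funext y
    have hD : fderiv ℝ (fun y => a • φ y) y = a • fderiv ℝ φ y := ((hφd y).hasFDerivAt.const_smul a).fderiv
    rw [curl_eq_curlCLM, curl_eq_curlCLM, hD, map_smul]
  have hωd : Differentiable ℝ (curl φ) := (contDiff_curl (n := 1) hφ).differentiable one_ne_zero
  have hD2 : fderiv ℝ (fun y => a • curl φ y) x = a • fderiv ℝ (curl φ) x := ((hωd x).hasFDerivAt.const_smul a).fderiv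
  rw [hcurl, hD2]

/-- **Pointwise decomposition of the palinstrophy integrand along the discrete slide** (see the module docstring). [folklore] -/
theorem inner_fderiv_curl_slideQuotient_smul (hV : ContDiff ℝ ∞ V) (hg : ContDiff ℝ ∞ g) (h : ℝ)
    (x u w : EuclideanSpace ℝ (Fin 3)) :
    ⟪u, fderiv ℝ (curl (fun x : EuclideanSpace ℝ (Fin 3) => (-h⁻¹) • (g (x 2) • V x - g ((x + (-h) • EuclideanSpace.single (2 : Fin 3) (1 : ℝ)) 2) • V (x + (-h) • EuclideanSpace.single (2 : Fin 3) (1 : ℝ)) - (∫ t in (-h)..0, deriv g ((x + t • EuclideanSpace.single (2 : Fin 3) (1 : ℝ)) 2) * V (x + t • EuclideanSpace.single (2 : Fin 3) (1 : ℝ)) 2) • EuclideanSpace.single (2 : Fin 3) (1 : ℝ)))) x w⟫ =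
      -(g (x 2 - h) * ⟪u, h⁻¹ • (fderiv ℝ (curl V) x w - fderiv ℝ (curl V) (x + (-h) • EuclideanSpace.single (2 : Fin 3) (1 : ℝ)) w)⟫) -
        h⁻¹ * (g (x 2) - g (x 2 - h)) * ⟪u, fderiv ℝ (curl V) x w⟫ -
        ⟪u, h⁻¹ • (((deriv g ((x) 2) • (EuclideanSpace.proj (2 : Fin 3) : EuclideanSpace ℝ (Fin 3) →L[ℝ] ℝ)).smulRight (curl V (x)) +
          (deriv g ((x) 2) • fderiv ℝ (fun z : EuclideanSpace ℝ (Fin 3) => (-V z 1) • EuclideanSpace.single (0 : Fin 3) (1 : ℝ) + (V z 0) • EuclideanSpace.single (1 : Fin 3) (1 : ℝ)) (x) +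
            (deriv (deriv g) ((x) 2) • (EuclideanSpace.proj (2 : Fin 3) : EuclideanSpace ℝ (Fin 3) →L[ℝ] ℝ)).smulRight
              ((-V (x) 1) • EuclideanSpace.single (0 : Fin 3) (1 : ℝ) + (V (x) 0) • EuclideanSpace.single (1 : Fin 3) (1 : ℝ)))) w -
          ((deriv g ((x + (-h) • EuclideanSpace.single (2 : Fin 3) (1 : ℝ)) 2) • (EuclideanSpace.proj (2 : Fin 3) : EuclideanSpace ℝ (Fin 3) →L[ℝ] ℝ)).smulRight (curl V (x + (-h) • EuclideanSpace.single (2 : Fin 3) (1 : ℝ))) +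
          (deriv g ((x + (-h) • EuclideanSpace.single (2 : Fin 3) (1 : ℝ)) 2) • fderiv ℝ (fun z : EuclideanSpace ℝ (Fin 3) => (-V z 1) • EuclideanSpace.single (0 : Fin 3) (1 : ℝ) + (V z 0) • EuclideanSpace.single (1 : Fin 3) (1 : ℝ)) (x + (-h) • EuclideanSpace.single (2 : Fin 3) (1 : ℝ)) +
            (deriv (deriv g) ((x + (-h) • EuclideanSpace.single (2 : Fin 3) (1 : ℝ)) 2) • (EuclideanSpace.proj (2 : Fin 3) : EuclideanSpace ℝ (Fin 3) →L[ℝ] ℝ)).smulRight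
              ((-V (x + (-h) • EuclideanSpace.single (2 : Fin 3) (1 : ℝ)) 1) • EuclideanSpace.single (0 : Fin 3) (1 : ℝ) + (V (x + (-h) • EuclideanSpace.single (2 : Fin 3) (1 : ℝ)) 0) • EuclideanSpace.single (1 : Fin 3) (1 : ℝ)))) w)⟫ +
        ⟪u, h⁻¹ • ((∫ t in (-h)..0, fderiv ℝ (fun y : EuclideanSpace ℝ (Fin 3) => fderiv ℝ (fun z : EuclideanSpace ℝ (Fin 3) => deriv g (z 2) * V z 2) y (EuclideanSpace.single (1 : Fin 3) (1 : ℝ)))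
            (x + t • EuclideanSpace.single (2 : Fin 3) (1 : ℝ)) w) • EuclideanSpace.single (0 : Fin 3) (1 : ℝ) -
          (∫ t in (-h)..0, fderiv ℝ (fun y : EuclideanSpace ℝ (Fin 3) => fderiv ℝ (fun z : EuclideanSpace ℝ (Fin 3) => deriv g (z 2) * V z 2) y (EuclideanSpace.single (0 : Fin 3) (1 : ℝ)))
            (x + t • EuclideanSpace.single (2 : Fin 3) (1 : ℝ)) w) • EuclideanSpace.single (1 : Fin 3) (1 : ℝ))⟫ := by
  set e₂ : EuclideanSpace ℝ (Fin 3) := EuclideanSpace.single (2 : Fin 3) (1 : ℝ) with he₂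
  have hV2 : ContDiff ℝ 2 V := hV.of_le (WithTop.coe_le_coe.mpr le_top)
  have hg2 : ContDiff ℝ 2 g := hg.of_le (WithTop.coe_le_coe.mpr le_top)
  have hφs : ContDiff ℝ ∞ (fun x : EuclideanSpace ℝ (Fin 3) => (g (x 2) • V x - g ((x + (-h) • e₂) 2) • V (x + (-h) • e₂) - (∫ t in (-h)..0, deriv g ((x + t • e₂) 2) * V (x + t • e₂) 2) • e₂)) :=
    contDiff_slideQuotient hV hg h
  -- pull out the constant `−h⁻¹`, split `D curl φ̂_h`, and insert `D curl Ψ = g Dω + R` at `x` and `x − he₂`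
  rw [fderiv_curl_const_smul (hφs.of_le (WithTop.coe_le_coe.mpr le_top)) (-h⁻¹) x, smul_apply,
    fderiv_curl_slideQuotient_apply hV hg h x w, (hasFDerivAt_curl_axialWeight_smul hV2 hg2 x).fderiv,
    (hasFDerivAt_curl_axialWeight_smul hV2 hg2 (x + (-h) • e₂)).fderiv]
  have hx2 : (x + (-h) • e₂) 2 = x 2 - h := by simp [he₂]; ring
  simp only [add_apply, smul_apply, hx2, inner_smul_right, inner_add_right, inner_sub_right]
  ring

end ExtremiserLiouville

end Summit.NavierStokesRegularity.NavierStokesRegularity.Theorems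

end
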